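import Summits.QuantumFields.BalabanUV.T4Continuum.Spine.NE4.FadingFromRateRelAnalytic

/-!
# Spine/NE4/FadingFromRateRelAnalyticU2 — node U2 from {REAL NE4, relative real-analytic charts} by the rate-loss fixed point in the LOG currency:
# ONE radius, NO asymptotic-freedom lower bound, NO window binder

Cell `pub-balaban-gaps` (YM blitz G2), seat `ne4`, generation 7 (unit `pub-balaban-gaps-ne4-g7`); record `HOME/ne/NE4.md` §5 (R40).  Sequel (§6) of
`Spine/NE4/FadingFromRateRelAnalytic`, whose headline `histLipschitzLog_fadingMemory_of_localAnalyticRel` gives, from the REAL `ScaleShiftRate c θ γ β`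
and `LocalAnalyticRel B γ ρ β`, the LOG-currency history moduli `T4CurrencyMatching.HistLipschitzBy Real.log Λ₂ γ β` with `∀ θ′ > θ, FadingMemory C₂(θ′) θ′ Λ₂`
and γ-FREE `Λ₂`, `C₂`.  Here node U2 closes by the tree's RATE-LOSS kernel in the log currency — `T4CurrencyMatching.injectedRate_of_runs_by` with
`currencyWeight_log` (sup weight `γ²∕2`, NO weight sum along the runs, hence NO `EventualLowerH`): for rates `θ < θ′ < ρ′ < 1` and the window
`C₂(θ′)·(γ²∕2)·ρ′∕(ρ′ − θ′) ≤ (1 − ρ′)∕2` — γ²-TYPE with γ-free constants, so it HOLDS for every `γ ≤ γ₀(c, θ, B, ρ, θ′, ρ′)` with the hypotheses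
and the runs on the SAME box (ONE RADIUS; `relWindow_of_small_box`) — consecutive IR-pinned runs match geometrically and K-uniformly at rate `ρ′`
(β-generic `injectedRate_of_localAnalyticRel`; data faces `u2Output_of_localAnalyticRel`, `u2Output_under_of_localAnalyticRel`; END TO END from
NE5 + (R) `u2Output_under_of_ne5_localAnalyticRel`).

RESULT FOR THE ROW (NE4.md (R40)): node U2's input list in its SIXTH and most print-faithful typed form — β-side {REAL NE4 as typed; relative
real-analytic charts of the REAL sections, uniform `(B, ρ)`}, flow-side {the PRINTED upper bound `BetaUpperH β′` with `γ²β′ < 1` (to run (0.20)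
forward), tuned runs} — NOTHING ELSE: no `EventualLowerH b γ k₀` (the AF lower-bound binder of `Targets.u2Output_of_u2Inputs` and of every earlier
`Spine/NE4` face), no second radius, no window binder, no complex family, no analyticity at `g = 0`; output `U2Output D g₀ (2c∕(1−ρ′)) ρ′` at any
`ρ′ ∈ ]θ,1[`.  HONEST FRAMING: bookkeeping over hypothesis shapes (NE4, `LocalAnalyticRel`, the upper bound are BINDERS, all UNPRINTED except TYPES);
nothing of Bałaban's asserted beyond print; NE4 NOT IN PRINT, NOT PROVED; binders 0∕6, spine 0∕9 unchanged; NOT continuum on ℝ⁴, NOT infinite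
volume, NOT a mass gap, NOT Clay.  0 sorry, 0 def; axioms standard; imports `Spine/NE4/FadingFromRateRelAnalytic` only.
Reference (TYPES only): [Balaban1987RG1] = T. Bałaban, CMP **109** (1987) 249–301, (0.20) p. 256, Thm 2 p. 259, §1 p. 264.
-/

noncomputable section

namespace Summit.QuantumFields.BalabanUV.T4Continuum.Spine.NE4

open Set Metric Filter Topology
open Literature.MathematicalPhysics.QuantumFieldTheory.Balaban1983to89
open Literature.MathematicalPhysics.QuantumFieldTheory.Balaban1983to89.FlowStep
open Literature.MathematicalPhysics.QuantumFieldTheory.Balaban1983to89.T4CouplingMatching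
open Literature.MathematicalPhysics.QuantumFieldTheory.Balaban1983to89.T4Continuum
open Literature.MathematicalPhysics.QuantumFieldTheory.Balaban1983to89.T4CurrencyMatching
  (HistLipschitzBy CurrencyWeight currencyWeight_log injectedRate_of_runs_by)
open Literature.MathematicalPhysics.QuantumFieldTheory.Balaban1983to89.T4TwoRunUniqueness (rgEqH_of_tuned)

universe u

/-! ## §6 Node U2 by the rate-loss fixed point in the log currency: ONE radius, NO asymptotic-freedom lower bound -/

/-- **NODE U2 FROM THE REAL NE4 + RELATIVE CHARTS, β-generic — NO `EventualLowerH`, ONE BOX.**  A family `g K` of IR-pinned runs of (0.20) in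
`]0,γ]` (run `K` against run `K+1`, all pinned at `gIR`), the REAL NE4 and `LocalAnalyticRel B γ ρ β` ON THE SAME BOX, rates `θ < θ′ < ρ′ < 1`
and the γ²-TYPE window `C₂(θ′)·(γ²∕2)·ρ′∕(ρ′ − θ′) ≤ (1 − ρ′)∕2` ⟹ `T4CauchySum.InjectedRate (2c∕(1−ρ′)) 0 ρ′ (disc of consecutive runs)` —
`T4CurrencyMatching.injectedRate_of_runs_by` in the currency `log` (sup weight `γ²∕2`, `currencyWeight_log`) fed by §5.  Every β-side
hypothesis UNPRINTED except TYPES. [cite: Balaban1987RG1, (0.20) p.256 and §1 p.264] -/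
theorem injectedRate_of_localAnalyticRel {β : HBeta} {c θ θ' ρ' γ ρ B : ℝ} (g : ℕ → ℕ → ℝ) (gIR : ℝ)
    (hL : LocalAnalyticRel B γ ρ β) (hS : ScaleShiftRate c θ γ β) (hc : 0 ≤ c) (hθ0 : 0 < θ) (hθ1 : θ < 1) (hB : 0 < B)
    (hρ : 0 < ρ) (hρ1 : ρ ≤ 1) (hγ : 0 < γ) (hθθ' : θ < θ') (hθ'ρ' : θ' < ρ') (hρ'1 : ρ' < 1)
    (hrun : ∀ K, RGEqH K β (g K)) (hbox : ∀ K i, i ≤ K → 0 < g K i ∧ g K i ≤ γ) (hpin : ∀ K, g K K = gIR)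
    (hsmall : relAnalyticFading c θ B ρ θ' * (γ ^ 2 / 2) * (ρ' / (ρ' - θ')) ≤ (1 - ρ') / 2) :
    T4CauchySum.InjectedRate (2 * c / (1 - ρ')) 0 ρ' fun K j => disc (g K) (g (K + 1)) j := by
  obtain ⟨hHL, hF⟩ := histLipschitzLog_fadingMemory_of_localAnalyticRel hL hS hc hθ0 hθ1 hB hρ hρ1 hγ
  exact injectedRate_of_runs_by (φ := Real.log) g gIR (hθ0.trans (hθθ'.trans hθ'ρ')) hρ'1 hθ0.le (hθθ'.trans hθ'ρ').le
    (hθ0.trans hθθ').le hθ'ρ' hc (relAnalyticFading_nonneg hc hθ0 hθ1 hρ θ') (by positivity) hrun hbox hpin hS hHL (hF θ' hθθ')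
    (currencyWeight_log hγ) hsmall

variable {F : T4Family} {G : Type u} [GaugeGroup G] [MeasurableSpace G] [HaarData G]

/-- **ON THE DATA: NODE U2's OUTPUT FROM NE4 FOR THE DATA + RELATIVE CHARTS — ONE BOX, NO `EventualLowerH`.**  `NE4OnData D c θ γ` and
`LocalAnalyticRel B γ ρ D.βfun` on `]0,γ]`, the PRINTED-type upper bound `BetaUpperH β′ γ` with `γ²β′ < 1` (only to run (0.20) forward,
`rgEqH_of_tuned`), a sequence `g₀` TUNED to `g` within `]0,γ]`, rates `θ < θ′ < ρ′ < 1` and the γ²-type window ⟹ `U2Output D g₀ (2c∕(1−ρ′)) ρ′`.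
Compare `Targets.u2Output_of_u2Inputs` (AF binder `EventualLowerH b γ k₀`, window `C((k₀+1)γ³ + 2γ∕b)`) and every earlier `Spine/NE4` face (two radii).
[folklore] -/
theorem u2Output_of_localAnalyticRel (D : FiniteEpsData F G) {c θ θ' ρ' γ ρ B β' gfin : ℝ} {g₀ : ℕ → ℝ}
    (hL : LocalAnalyticRel B γ ρ D.βfun) (hN : NE4OnData D c θ γ) (hc : 0 ≤ c) (hθ0 : 0 < θ) (hθ1 : θ < 1) (hB : 0 < B)
    (hρ : 0 < ρ) (hρ1 : ρ ≤ 1) (hγ : 0 < γ) (hθθ' : θ < θ') (hθ'ρ' : θ' < ρ') (hρ'1 : ρ' < 1)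
    (hhi : BetaUpperH β' γ D.βfun) (hγβ : γ ^ 2 * β' < 1) (ht : D.Tuned γ gfin g₀)
    (hsmall : relAnalyticFading c θ B ρ θ' * (γ ^ 2 / 2) * (ρ' / (ρ' - θ')) ≤ (1 - ρ') / 2) :
    U2Output D g₀ (2 * c / (1 - ρ')) ρ' := by
  obtain ⟨hbox, hpin⟩ := box_and_pin_of_tuned D ht
  exact injectedRate_of_localAnalyticRel (runFlow D g₀) gfin hL hN hc hθ0 hθ1 hB hρ hρ1 hγ hθθ' hθ'ρ' hρ'1
    (fun K => rgEqH_of_tuned D hhi hγβ hγ le_rfl ht K) hbox hpin hsmall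

/-- [bookkeeping] THE γ²-TYPE WINDOW HOLDS ON SMALL BOXES: `0 ≤ C`, rates `θ′ < ρ′ < 1`, `0 < γ ≤ 1` and
`γ ≤ (1 − ρ′)(ρ′ − θ′)∕(ρ′(C + 1))` give `C·(γ²∕2)·ρ′∕(ρ′ − θ′) ≤ (1 − ρ′)∕2`. [folklore] -/
theorem relWindow_of_small_box {C θ' ρ' γ : ℝ} (hC : 0 ≤ C) (hθ'ρ' : θ' < ρ') (hρ'0 : 0 < ρ') (hρ'1 : ρ' < 1)
    (hγ0 : 0 < γ) (hγ1 : γ ≤ 1) (hγW : γ ≤ (1 - ρ') * (ρ' - θ') / (ρ' * (C + 1))) :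
    C * (γ ^ 2 / 2) * (ρ' / (ρ' - θ')) ≤ (1 - ρ') / 2 := by
  have hd : 0 < ρ' - θ' := by linarith
  have hC1 : 0 < C + 1 := by linarith
  have hγ2 : γ ^ 2 ≤ γ := by nlinarith
  have hW : γ * (ρ' * (C + 1)) ≤ (1 - ρ') * (ρ' - θ') := (le_div_iff₀ (by positivity)).mp hγW
  rw [show C * (γ ^ 2 / 2) * (ρ' / (ρ' - θ')) = C * γ ^ 2 * ρ' / (2 * (ρ' - θ')) by field_simp,
    div_le_div_iff₀ (by positivity) (by norm_num : (0 : ℝ) < 2)]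
  nlinarith [mul_le_mul_of_nonneg_left hγ2 (mul_nonneg hC hρ'0.le), mul_nonneg hC hρ'0.le]

/-- **ONE RADIUS, NO WINDOW BINDER, NO AF LOWER BOUND — NODE U2's OUTPUT UNDER THE TARGETS' PREFIX.**  With NE4 for the data and
`LocalAnalyticRel B γᵤ ρ D.βfun` on a box `]0,γᵤ]`, the PRINTED-type upper bound `BetaUpperH β′ γᵤ` with `γᵤ²β′ < 1`, and rates `θ < θ′ < ρ′ < 1`:
`U2Output D g₀ (2c∕(1−ρ′)) ρ′` for EVERY run box `γ ≤ γ₀ := min(γᵤ, 1, (1 − ρ′)(ρ′ − θ′)∕(ρ′(C₂ + 1)))`, every `g`, every tuned `g₀` — the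
hypotheses are USED on the run box itself (restriction, `localAnalyticRel`'s box monotonicity is not even needed beyond `x ∈ ]0,γ] ⊆ ]0,γᵤ]`);
`γ₀ < γᵤ` only through the explicit γ²-window, whose constant `C₂ = relAnalyticFading c θ B ρ θ′` does NOT involve `γᵤ` (contrast (R29)∕(R37)∕(R39):
`K ∝ 1∕γᵤ`).  NO `EventualLowerH b γ k₀`, NO `b`, NO `k₀`. [folklore] -/
theorem u2Output_under_of_localAnalyticRel (D : FiniteEpsData F G) {Hβ : Prop} {c θ θ' ρ' γu ρ B β' : ℝ}
    (hL : LocalAnalyticRel B γu ρ D.βfun) (hN : NE4OnData D c θ γu) (hc : 0 ≤ c) (hθ0 : 0 < θ) (hθ1 : θ < 1) (hB : 0 < B)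
    (hρ : 0 < ρ) (hρ1 : ρ ≤ 1) (hγu : 0 < γu) (hθθ' : θ < θ') (hθ'ρ' : θ' < ρ') (hρ'1 : ρ' < 1)
    (hhi : BetaUpperH β' γu D.βfun) (hγβ : γu ^ 2 * β' < 1) :
    D.UnderHypotheses Hβ fun g₀ => U2Output D g₀ (2 * c / (1 - ρ')) ρ' := by
  intro _ _
  set C₁ : ℝ := relAnalyticFading c θ B ρ θ' with hC₁
  have hC : 0 ≤ C₁ := relAnalyticFading_nonneg hc hθ0 hθ1 hρ θ'
  have hρ'0 : 0 < ρ' := hθ0.trans (hθθ'.trans hθ'ρ')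
  have hWpos : 0 < (1 - ρ') * (ρ' - θ') / (ρ' * (C₁ + 1)) :=
    div_pos (mul_pos (by linarith) (by linarith)) (mul_pos hρ'0 (by linarith))
  set γ₀ : ℝ := min γu (min 1 ((1 - ρ') * (ρ' - θ') / (ρ' * (C₁ + 1)))) with hγ₀
  refine ⟨γ₀, lt_min hγu (lt_min one_pos hWpos), fun γ hγ hγle => ⟨1, one_pos, fun g _ _ g₀ ht => ?_⟩⟩
  have hγu' : γ ≤ γu := hγle.trans (min_le_left _ _)
  have hγ1 : γ ≤ 1 := hγle.trans ((min_le_right _ _).trans (min_le_left _ _))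
  have hγW : γ ≤ (1 - ρ') * (ρ' - θ') / (ρ' * (C₁ + 1)) := hγle.trans ((min_le_right _ _).trans (min_le_right _ _))
  -- restrict the hypotheses to the run box `]0,γ]`
  have hL' : LocalAnalyticRel B γ ρ D.βfun := fun k p hp i x hx => by
    obtain ⟨Φ, hd, hb, ha⟩ := hL k p (box_mono hγu' k hp) i x ⟨hx.1, hx.2.trans hγu'⟩
    exact ⟨Φ, hd, hb, fun t htm htx => ha t ⟨htm.1, htm.2.trans hγu'⟩ htx⟩
  have hγβ' : γ ^ 2 * β' < 1 := by
    rcases le_or_gt β' 0 with hb | hb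
    · exact lt_of_le_of_lt (mul_nonpos_of_nonneg_of_nonpos (sq_nonneg γ) hb) one_pos
    · exact lt_of_le_of_lt (mul_le_mul_of_nonneg_right (pow_le_pow_left₀ hγ.le hγu' 2) hb.le) hγβ
  exact u2Output_of_localAnalyticRel D hL' (fun k w hw => hN k w (box_mono hγu' (k + 1) hw)) hc hθ0 hθ1 hB hρ hρ1 hγ hθθ'
    hθ'ρ' hρ'1 (fun k v hv => hhi k v (box_mono hγu' k hv)) hγβ' ht (relWindow_of_small_box hC hθ'ρ' hρ'0 hρ'1 hγ hγ1 hγW)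

/-- **END TO END: NODE U2's OUTPUT UNDER THE TARGETS' PREFIX ⇐ NE5 + (R) + RELATIVE CHARTS + THE PRINTED UPPER BOUND — nothing else.**  NE4 for
the data from NE5 for every unpaired coupling + the covariant read-out (`T4BetaReadOutLipschitz.scaleShiftRate_of_ne5_on`, BY NAME); the history
companions from `LocalAnalyticRel B γᵤ ρ D.βfun` in the log currency; node U2 by the rate-loss fixed point.  NO NE9, NO U3 fading memory, NO complex
family, NO `EventualLowerH`, NO window binder, ONE radius.  Every input UNPRINTED except TYPES. [folklore] -/
theorem u2Output_under_of_ne5_localAnalyticRel (D : FiniteEpsData F G) {Hβ : Prop} {C : T4OutputRate.Carriers} {W : Set (ℕ → ℝ)}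
    {EA : T4OutputRate.Functional C C.BgA} {EB : ℝ → T4OutputRate.Functional C C.BgB}
    {𝒜A : Set (T4BetaReadOut.Slice C C.BgA)} {𝒜B : Set (T4BetaReadOut.Slice C C.BgB)} {rA : T4BetaReadOut.ReadOut C C.BgA}
    {rB : T4BetaReadOut.ReadOut C C.BgB} {γu κ θ θ' ρ' C₅ cr ρ B β' : ℝ}
    (hW : ∀ k (v : Fin (k + 1) → ℝ), v ∈ Box γu k → T4FlagMemory.extd v ∈ W)
    (h5 : ∀ b, 0 < b → b ≤ γu → T4OutputRate.NE5 EA (EB b) W κ θ C₅) (hA : T4BetaReadOut.RepresentsA EA rA γu D.βfun)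
    (hB : T4BetaReadOut.RepresentsB EB rB γu D.βfun) (h𝒜A : ∀ g ∈ W, EA g ∈ 𝒜A)
    (h𝒜B : ∀ b, 0 < b → b ≤ γu → ∀ g ∈ W, EB b g ∈ 𝒜B) (hcov : T4BetaReadOutLipschitz.ReadCovariantOn 𝒜A 𝒜B rA rB κ cr)
    (hcr : 0 ≤ cr) (hC₅ : 0 ≤ C₅) (hθ0 : 0 < θ) (hθ1 : θ < 1) (hL : LocalAnalyticRel B γu ρ D.βfun) (hBpos : 0 < B)
    (hρ : 0 < ρ) (hρ1 : ρ ≤ 1) (hγu : 0 < γu) (hθθ' : θ < θ') (hθ'ρ' : θ' < ρ') (hρ'1 : ρ' < 1)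
    (hhi : BetaUpperH β' γu D.βfun) (hγβ : γu ^ 2 * β' < 1) :
    D.UnderHypotheses Hβ fun g₀ => U2Output D g₀ (2 * (cr * C₅ * θ) / (1 - ρ')) ρ' :=
  u2Output_under_of_localAnalyticRel D hL (T4BetaReadOutLipschitz.scaleShiftRate_of_ne5_on hW h5 hA hB h𝒜A h𝒜B hcov)
    (mul_nonneg (mul_nonneg hcr hC₅) hθ0.le) hθ0 hθ1 hBpos hρ hρ1 hγu hθθ' hθ'ρ' hρ'1 hhi hγβ

end Summit.QuantumFields.BalabanUV.T4Continuum.Spine.NE4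

end
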